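import Mathlib.RingTheory.RootsOfUnity.Basic
import Mathlib.GroupTheory.QuotientGroup.Basic
import Literature.AnabelianGeometry.EtaleTheta.Cyclotome

/-!
# The cyclotome modulo `N` is the `N`-torsion: `Λ(A) ⊗ ℤ/Nℤ ≅ A[N]`

Topic `Literature/AnabelianGeometry/EtaleTheta`, companion of `Cyclotome.lean` (the inverse-limit
cyclotome `Λ(A) = lim_{← n} A[n]` of a commutative group `A`, [cite: LANA2026Report, §6.1 p.31]).
Classical fact used throughout [AbsTopIII] §3 / [IUTchII] §1 whenever a cyclotome
`μ_Ẑ(M) := Hom(ℚ/ℤ, M) ≅ Λ(M)` ([AbsTopIII] Def. 3.1 (v), kurims p. 69) is reduced modulo `N`: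
"`μ_N(S)` corresponds to `μ_Ẑ(M_TM) ⊗ (ℤ/Nℤ)`" ([IUTchII] Prop. 1.3 (ii), kurims p. 26 l. 31–33), i.e.

  `Λ(A) / Λ(A)^N  ⥲  A[N] = {z ∈ A | z^N = 1}`,   `ζ = (ζ_n)_n ↦ ζ_N`,

an isomorphism as soon as the `N`-torsion points of `A` extend to compatible systems of roots of
unity (e.g. `A` divisible = Mathlib `RootableBy A ℕ`; for `A = k̄ˣ`, `k̄` algebraically closed, the
instance is the tree's `rootableByUnitsOfIsAlgClosed` / `IsAlgClosed.rootableByUnits`).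

What is here (everything PROVED; the only definitions are the maps themselves):

* `cyclotome.evalHom N : Λ(A) →* A`, `ζ ↦ ζ_N`, landing in the `N`-torsion
  `(powMonoidHom N : A →* A).ker` (`cyclotome.torsionHom N`); equivariant for any group acting on
  `A` by automorphisms (`evalHom_smul`) and natural in `A` (`evalHom_map`).
* `cyclotome.nthRootOfEvalEqOne` — UNCONDITIONALLY, an element `ζ ∈ Λ(A)` with `ζ_N = 1` is an
  `N`-th power inside `Λ(A)`: `ξ_n := ζ_{nN}` satisfies `ξ^N = ζ`.  Hence
  `cyclotome.ker_torsionHom`: the kernel of `ζ ↦ ζ_N` is EXACTLY the subgroup of `N`-th powers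
  (in the commutative group `Λ(A)` the normal closure of the `N`-th powers is their range),
  written as `Subgroup.normalClosure (Set.range fun a => a ^ N)` so that the quotient below is
  literally `Literature.IUT.HodgeArakelov.ModPow (cyclotome A) N` ([IUTchII] Def 1.1 (ii) "`⊗ ℤ/Nℤ`",
  an `abbrev` for `A ⧸ normalClosure (range (· ^ N))`; this file does not import it).
* `cyclotome.modNHom N : Λ(A) ⧸ Λ(A)^N →* A[N]` and `modNHom_injective` — no hypothesis on `A`.
* `cyclotome.torsionHom_surjective_iff` — surjective iff every `z` with `z^N = 1` is the `N`-th
  component of some element of `Λ(A)`; `torsionHom_surjective` — this holds when `A` is rootable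
  (`ζ_n := x_n^N` for a compatible root system `x` of `z`, `RootSystem.ofRootableBy`).
* `cyclotome.modNEquiv N : Λ(A) ⧸ Λ(A)^N ≃* (powMonoidHom N).ker` (`[RootableBy A ℕ]`),
  `cyclotome.kerPowEquivRootsOfUnity : (powMonoidHom N : A →* A).ker ≃* rootsOfUnity N A`, and the
  field form `cyclotome.unitsModNEquivRootsOfUnity K N : Λ(Kˣ) ⧸ Λ(Kˣ)^N ≃* rootsOfUnity N K`
  ("`μ_Ẑ(k̄ˣ) ⊗ ℤ/Nℤ = μ_N(k̄)`").

Not here: the profinite topology on `Λ(A)`; the `Ẑ`-module structure; finiteness of `A[N]` (not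
needed for any statement in this file).
-/

namespace Literature.AnabelianGeometry.EtaleTheta

namespace cyclotome

open Function

universe u

variable {A : Type u} [CommGroup A]

/-! ### Evaluation at level `N` -/

/-- Evaluation of a compatible system at level `N`: `Λ(A) →* A`, `ζ ↦ ζ_N` (the projection of the
inverse limit `lim_n A[n]` to its `N`-th term). [cite: LANA2026Report, §6.1 p.31] -/
def evalHom (N : ℕ+) : cyclotome A →* A :=
  (Pi.evalMonoidHom (fun _ : ℕ+ => A) N).comp (cyclotome A).subtype

/-- `evalHom N ζ = ζ_N`. [cite: LANA2026Report, §6.1 p.31] -/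
@[simp] theorem evalHom_apply (N : ℕ+) (ζ : cyclotome A) : evalHom N ζ = (ζ : ℕ+ → A) N := rfl

/-- `ζ_N` is `N`-torsion. [cite: LANA2026Report, §6.1 p.31] -/
theorem evalHom_pow (N : ℕ+) (ζ : cyclotome A) : evalHom N ζ ^ (N : ℕ) = 1 :=
  pow_eq_one ζ N

/-- `ζ_N` lies in the `N`-torsion subgroup `A[N] = ker (z ↦ z^N)`. [cite: LANA2026Report, §6.1 p.31] -/
theorem evalHom_mem_ker_powMonoidHom (N : ℕ+) (ζ : cyclotome A) :
    evalHom N ζ ∈ (powMonoidHom (N : ℕ) : A →* A).ker := by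
  rw [MonoidHom.mem_ker, powMonoidHom_apply, evalHom_pow]

/-- Equivariance of `ζ ↦ ζ_N` for a group acting on `A` by automorphisms (the cyclotome carries the
componentwise action, `cyclotome.instMulDistribMulAction`). [cite: LANA2026Report, §6.1 p.31] -/
theorem evalHom_smul {G : Type*} [Group G] [MulDistribMulAction G A] (g : G) (N : ℕ+)
    (ζ : cyclotome A) : evalHom N (g • ζ) = g • evalHom N ζ := rfl

/-- Naturality of `ζ ↦ ζ_N` in `A`: it commutes with `Λ(φ)` for `φ : A →* B`.
[cite: LANA2026Report, §6.1 p.32] -/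
theorem evalHom_map {B : Type*} [CommGroup B] (φ : A →* B) (N : ℕ+) (ζ : cyclotome A) :
    evalHom N (map φ ζ) = φ (evalHom N ζ) := rfl

/-- `Λ(A) →* A[N]`, `ζ ↦ ζ_N`, with target the `N`-torsion subgroup `(powMonoidHom N).ker` of `A`
("`Λ(A) ⊗ ℤ/Nℤ → A[N]`" before passing to the quotient). [cite: LANA2026Report, §6.1 p.31] -/
def torsionHom (N : ℕ+) : cyclotome A →* (powMonoidHom (N : ℕ) : A →* A).ker :=
  (evalHom N).codRestrict _ (evalHom_mem_ker_powMonoidHom N)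

/-- Underlying element of `torsionHom N ζ`. [cite: LANA2026Report, §6.1 p.31] -/
@[simp] theorem coe_torsionHom_apply (N : ℕ+) (ζ : cyclotome A) :
    ((torsionHom N ζ : (powMonoidHom (N : ℕ) : A →* A).ker) : A) = (ζ : ℕ+ → A) N := rfl

/-! ### `N`-th roots inside the cyclotome: the kernel of `ζ ↦ ζ_N` is `Λ(A)^N` -/

/-- If `ζ_N = 1` then the shifted family `ξ_n := ζ_{nN}` is again a compatible system.
[cite: LANA2026Report, §6.1 p.31] -/
theorem shift_mem (N : ℕ+) (ζ : cyclotome A) (h : (ζ : ℕ+ → A) N = 1) :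
    (fun n : ℕ+ => (ζ : ℕ+ → A) (n * N)) ∈ cyclotome A := by
  refine ⟨fun n => ?_, fun n m => ?_⟩
  · -- `ζ_{nN}^n = ζ_{Nn}^n = ζ_N = 1`
    have := pow_apply_mul ζ N n
    rw [mul_comm] at this
    simp only [this, h]
  · -- `ζ_{nmN}^m = ζ_{(nN)m}^m = ζ_{nN}`
    have := pow_apply_mul ζ (n * N) m
    simp only [mul_right_comm n m N, this]

/-- The `N`-th root `ξ = (ζ_{nN})_n ∈ Λ(A)` of an element `ζ` with `ζ_N = 1`.
[cite: LANA2026Report, §6.1 p.31] -/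
def nthRootOfEvalEqOne (N : ℕ+) (ζ : cyclotome A) (h : (ζ : ℕ+ → A) N = 1) : cyclotome A :=
  ⟨fun n => (ζ : ℕ+ → A) (n * N), shift_mem N ζ h⟩

/-- Components of the `N`-th root. [cite: LANA2026Report, §6.1 p.31] -/
@[simp] theorem coe_nthRootOfEvalEqOne_apply (N : ℕ+) (ζ : cyclotome A) (h : (ζ : ℕ+ → A) N = 1)
    (n : ℕ+) : ((nthRootOfEvalEqOne N ζ h : cyclotome A) : ℕ+ → A) n = (ζ : ℕ+ → A) (n * N) := rfl

/-- `ξ^N = ζ`: an element of `Λ(A)` with trivial `N`-th component is an `N`-th power IN `Λ(A)`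
(no hypothesis on `A`). [cite: LANA2026Report, §6.1 p.31] -/
theorem nthRootOfEvalEqOne_pow (N : ℕ+) (ζ : cyclotome A) (h : (ζ : ℕ+ → A) N = 1) :
    nthRootOfEvalEqOne N ζ h ^ (N : ℕ) = ζ := by
  refine Subtype.ext (funext fun n => ?_)
  rw [Subgroup.coe_pow, Pi.pow_apply, coe_nthRootOfEvalEqOne_apply, pow_apply_mul]

/-- The kernel of `ζ ↦ ζ_N` consists of the `N`-th powers. [cite: LANA2026Report, §6.1 p.31] -/
theorem mem_range_powMonoidHom_of_eval_eq_one (N : ℕ+) (ζ : cyclotome A)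
    (h : (ζ : ℕ+ → A) N = 1) :
    ζ ∈ (powMonoidHom (N : ℕ) : cyclotome A →* cyclotome A).range :=
  ⟨nthRootOfEvalEqOne N ζ h, nthRootOfEvalEqOne_pow N ζ h⟩

/-- In the commutative group `Λ(A)` the normal closure of the set of `N`-th powers is just the
subgroup of `N`-th powers (the range of `a ↦ a^N`). [folklore] -/
private theorem normalClosure_range_pow_eq (N : ℕ) :
    Subgroup.normalClosure (Set.range fun a : cyclotome A => a ^ N) =
      (powMonoidHom N : cyclotome A →* cyclotome A).range := by
  apply le_antisymm
  · exact Subgroup.normalClosure_le_normal (by rintro _ ⟨a, rfl⟩; exact ⟨a, rfl⟩)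
  · rintro _ ⟨a, rfl⟩
    exact Subgroup.subset_normalClosure ⟨a, rfl⟩

/-- **The kernel of `Λ(A) → A[N]`, `ζ ↦ ζ_N`, is exactly `Λ(A)^N`** — written as the normal closure
of the `N`-th powers, so that the quotient by it is literally the tree's
`Literature.IUT.HodgeArakelov.ModPow (cyclotome A) N` ("`Λ(A) ⊗ ℤ/Nℤ`"). No hypothesis on `A`.
[cite: LANA2026Report, §6.1 p.31] -/
theorem ker_torsionHom (N : ℕ+) :
    (torsionHom (A := A) N).ker = Subgroup.normalClosure (Set.range fun a : cyclotome A => a ^ (N : ℕ)) := by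
  rw [normalClosure_range_pow_eq]
  ext ζ
  constructor
  · intro h
    rw [MonoidHom.mem_ker] at h
    have h' : (ζ : ℕ+ → A) N = 1 := by
      have := congrArg (fun x : (powMonoidHom (N : ℕ) : A →* A).ker => (x : A)) h
      simpa using this
    exact mem_range_powMonoidHom_of_eval_eq_one N ζ h'
  · rintro ⟨ξ, rfl⟩
    rw [MonoidHom.mem_ker]
    refine Subtype.ext ?_
    simp only [coe_torsionHom_apply, powMonoidHom_apply, Subgroup.coe_pow, Pi.pow_apply,
      OneMemClass.coe_one]
    exact pow_eq_one ξ N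

/-! ### The injection `Λ(A)/Λ(A)^N ↪ A[N]` (unconditional) -/

/-- **`Λ(A) ⊗ ℤ/Nℤ → A[N]`**: the homomorphism induced by `ζ ↦ ζ_N` on the quotient of `Λ(A)` by its
`N`-th powers (source literally `Literature.IUT.HodgeArakelov.ModPow (cyclotome A) N`).
[cite: LANA2026Report, §6.1 p.31] -/
def modNHom (N : ℕ+) :
    cyclotome A ⧸ Subgroup.normalClosure (Set.range fun a : cyclotome A => a ^ (N : ℕ)) →*
      (powMonoidHom (N : ℕ) : A →* A).ker :=
  (QuotientGroup.kerLift (torsionHom N)).comp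
    (QuotientGroup.quotientMulEquivOfEq (ker_torsionHom N).symm).toMonoidHom

/-- `modNHom` on representatives: `[ζ] ↦ ζ_N`. [cite: LANA2026Report, §6.1 p.31] -/
@[simp] theorem modNHom_mk (N : ℕ+) (ζ : cyclotome A) :
    modNHom N (QuotientGroup.mk ζ) = torsionHom N ζ := rfl

/-- **`Λ(A)/Λ(A)^N → A[N]` is injective**, for every commutative group `A` and every `N ≥ 1`.
[cite: LANA2026Report, §6.1 p.31] -/
theorem modNHom_injective (N : ℕ+) : Injective (modNHom (A := A) N) :=
  (QuotientGroup.kerLift_injective (torsionHom N)).comp (MulEquiv.injective _)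

/-! ### Surjectivity: `N`-torsion points that extend to compatible systems -/

/-- `ζ ↦ ζ_N` maps `Λ(A)` ONTO `A[N]` iff every `N`-torsion element of `A` is the `N`-th component of
a compatible system of roots of unity. [cite: LANA2026Report, §6.1 p.31] -/
theorem torsionHom_surjective_iff (N : ℕ+) :
    Surjective (torsionHom (A := A) N) ↔
      ∀ z : A, z ^ (N : ℕ) = 1 → ∃ ζ : cyclotome A, (ζ : ℕ+ → A) N = z := by
  constructor
  · intro h z hz
    obtain ⟨ζ, hζ⟩ := h ⟨z, by rw [MonoidHom.mem_ker, powMonoidHom_apply, hz]⟩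
    exact ⟨ζ, by simpa using congrArg (fun x : (powMonoidHom (N : ℕ) : A →* A).ker => (x : A)) hζ⟩
  · rintro h ⟨z, hz⟩
    rw [MonoidHom.mem_ker, powMonoidHom_apply] at hz
    obtain ⟨ζ, hζ⟩ := h z hz
    exact ⟨ζ, Subtype.ext (by simpa using hζ)⟩

/-- From a compatible system `x` of roots of an `N`-torsion element `z` (`x_n^n = z`,
`x_{nm}^m = x_n`) one gets the compatible system of roots of unity `ζ_n := x_n^N` with `ζ_N = z`.
[cite: LANA2026Report, §6.1 p.31] -/
theorem rootSystem_pow_mem (N : ℕ+) {z : A} (hz : z ^ (N : ℕ) = 1) (x : RootSystem z) :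
    (fun n : ℕ+ => x.root n ^ (N : ℕ)) ∈ cyclotome A := by
  refine ⟨fun n => ?_, fun n m => ?_⟩
  · simp only
    rw [← pow_mul, mul_comm (N : ℕ) (n : ℕ), pow_mul, x.pow_self, hz]
  · simp only
    rw [← pow_mul, mul_comm (N : ℕ) (m : ℕ), pow_mul, x.root_mul_pow]

/-- In a rootable (divisible) commutative group every `N`-torsion element is the `N`-th component
of an element of the cyclotome. [cite: LANA2026Report, §6.1 p.31] -/
theorem exists_eval_eq_of_pow_eq_one [RootableBy A ℕ] (N : ℕ+) {z : A} (hz : z ^ (N : ℕ) = 1) :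
    ∃ ζ : cyclotome A, (ζ : ℕ+ → A) N = z :=
  ⟨⟨fun n => (RootSystem.ofRootableBy z).root n ^ (N : ℕ),
      rootSystem_pow_mem N hz (RootSystem.ofRootableBy z)⟩,
    (RootSystem.ofRootableBy z).pow_self N⟩

/-- **`Λ(A) → A[N]` is surjective when `A` is rootable.** [cite: LANA2026Report, §6.1 p.31] -/
theorem torsionHom_surjective [RootableBy A ℕ] (N : ℕ+) : Surjective (torsionHom (A := A) N) :=
  (torsionHom_surjective_iff N).mpr fun _ hz => exists_eval_eq_of_pow_eq_one N hz

/-- **`Λ(A) ⊗ ℤ/Nℤ ≅ A[N]`** for a rootable commutative group `A`: the isomorphism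
`Λ(A) ⧸ Λ(A)^N ⥲ ker (z ↦ z^N)` induced by `ζ ↦ ζ_N` (source literally
`Literature.IUT.HodgeArakelov.ModPow (cyclotome A) N`). This is the identification
"`μ_Ẑ(M) ⊗ (ℤ/Nℤ)` = the `N`-torsion" behind [IUTchII] Prop. 1.3 (ii) (kurims p. 26 l. 31–33) and
[AbsTopIII] Def. 3.1 (v). [cite: LANA2026Report, §6.1 p.31] -/
noncomputable def modNEquiv [RootableBy A ℕ] (N : ℕ+) :
    cyclotome A ⧸ Subgroup.normalClosure (Set.range fun a : cyclotome A => a ^ (N : ℕ)) ≃*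
      (powMonoidHom (N : ℕ) : A →* A).ker :=
  MulEquiv.ofBijective (modNHom N)
    ⟨modNHom_injective N, fun z => by
      obtain ⟨ζ, rfl⟩ := torsionHom_surjective N z
      exact ⟨QuotientGroup.mk ζ, rfl⟩⟩

/-- `modNEquiv` on representatives: `[ζ] ↦ ζ_N`. [cite: LANA2026Report, §6.1 p.31] -/
@[simp] theorem coe_modNEquiv_mk [RootableBy A ℕ] (N : ℕ+) (ζ : cyclotome A) :
    ((modNEquiv N (QuotientGroup.mk ζ) : (powMonoidHom (N : ℕ) : A →* A).ker) : A) =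
      (ζ : ℕ+ → A) N := rfl

/-! ### Comparison with Mathlib's `rootsOfUnity` -/

/-- The `N`-torsion subgroup `ker (z ↦ z^N)` of a commutative GROUP `A` is Mathlib's `rootsOfUnity N A`
(a subgroup of the units `Aˣ`) along `toUnits : A ≃* Aˣ`. [folklore] -/
noncomputable def kerPowEquivRootsOfUnity (N : ℕ) :
    (powMonoidHom N : A →* A).ker ≃* rootsOfUnity N A where
  toFun z := ⟨toUnits (z : A), by
    rw [mem_rootsOfUnity, ← map_pow, ← powMonoidHom_apply, (MonoidHom.mem_ker).mp z.2, map_one]⟩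
  invFun u := ⟨((u : Aˣ) : A), by
    rw [MonoidHom.mem_ker, powMonoidHom_apply, ← Units.val_pow_eq_pow_val,
      (mem_rootsOfUnity N (u : Aˣ)).mp u.2, Units.val_one]⟩
  left_inv z := by ext; simp
  right_inv u := by ext; simp
  map_mul' z w := by ext; simp

/-- **`Λ(A) ⊗ ℤ/Nℤ ≅ rootsOfUnity N A`** (rootable commutative group `A`), the composite of
`modNEquiv` with `kerPowEquivRootsOfUnity`. [cite: LANA2026Report, §6.1 p.31] -/
noncomputable def modNEquivRootsOfUnity [RootableBy A ℕ] (N : ℕ+) :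
    cyclotome A ⧸ Subgroup.normalClosure (Set.range fun a : cyclotome A => a ^ (N : ℕ)) ≃*
      rootsOfUnity N A :=
  (modNEquiv N).trans (kerPowEquivRootsOfUnity N)

/-- The field form **`μ_Ẑ(k̄ˣ) ⊗ ℤ/Nℤ = μ_N(k̄)`**: for a field `K` whose unit group is rootable (e.g.
`K` algebraically closed: `rootableByUnitsOfIsAlgClosed K` / `IsAlgClosed.rootableByUnits K` in the
tree), `Λ(Kˣ) ⧸ Λ(Kˣ)^N ⥲ rootsOfUnity N K`, `[ζ] ↦ ζ_N` (Mathlib's `rootsOfUnity N K` IS the kernel of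
`z ↦ z^N` on `Kˣ`, `rootsOfUnity_eq_ker`). Source literally
`Literature.IUT.HodgeArakelov.ModPow (cyclotome Kˣ) N`. [cite: LANA2026Report, §6.1 p.31] -/
noncomputable def unitsModNEquivRootsOfUnity (K : Type u) [Field K] [RootableBy Kˣ ℕ] (N : ℕ+) :
    cyclotome Kˣ ⧸ Subgroup.normalClosure (Set.range fun a : cyclotome Kˣ => a ^ (N : ℕ)) ≃*
      rootsOfUnity N K :=
  (modNEquiv N).trans (MulEquiv.subgroupCongr rootsOfUnity_eq_ker.symm)

/-- The field isomorphism on representatives: `[ζ] ↦ ζ_N`. [cite: LANA2026Report, §6.1 p.31] -/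
@[simp] theorem coe_unitsModNEquivRootsOfUnity_mk (K : Type u) [Field K] [RootableBy Kˣ ℕ] (N : ℕ+)
    (ζ : cyclotome Kˣ) :
    ((unitsModNEquivRootsOfUnity K N (QuotientGroup.mk ζ) : rootsOfUnity N K) : Kˣ) =
      (ζ : ℕ+ → Kˣ) N := rfl

end cyclotome

end Literature.AnabelianGeometry.EtaleTheta
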